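import Summits.QuantumFields.YangMills.Theses.SmallCircleAnchor

/-!
# Route `SmallCircleAnchor` — crux `AdiabaticContinuity` (stmt-QuantumFields-11142), line `registered`, stub `stub_decompactificationUniform`

Stub file of the crux skeleton `Cruxes/AdiabaticContinuity/Lines/birth.lean` (reshape r1, lead
prover-line-stmt-QuantumFields-11142-0; proof by the wave-1 stub worker). The registered stub is

  `theorem stub_decompactificationUniform : DecompactificationUniform`

— the CORNER of the adiabatic path in its soft form: if, for `β ≥ β₁`, one rate `m > 0` and, for
every cube side `w`, ONE constant `C` cluster the `(T', E(β)·V)`-deformed finite-temperature Wilson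
theory on `ℤ_{T'} × (ℤ/L)³` in the spatial direction `0` for EVERY temporal extent `T' ≥ T` and every
`L` (Leg A with `T'`-uniform constants, verbatim the conclusion of the skeleton's
`ThermalContinuationUniform`), then the fully deformed theory on the SYMMETRIC torus `ℤ_L × (ℤ/L)³`
clusters uniformly in `L` — the crux's `Cl (fun L => L) (E β) β m`, definitionally.

Why the reshape (recorded in the skeleton's module docstring and the lead's NOTES.md): the planner's
corner `Decompactification` took Leg A with constants `C(w, T')`; its only legal instantiation
`T' := L` leaves `C(w, L)`, and per-`T'` constants plus `|corr| ≤ 2` never yield one diagonal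
constant (abstract witness `a T' L n = 2·𝟙{n ≤ T'}`), so the corner's whole content is the
uniformity in `T'`, now part of Leg A.

Proof: `T' := L` for `L ≥ T` (the diagonal lattice IS the `T' = L` lattice); for `L < T` the
trivial bound `2 ≤ 2e^{mT}e^{-mn}` (`n < L < T`), which needs that the inline `Ex` is an honest
normalised Gibbs mean: the weight `wgt = exp(act − s Σₓ V(Pₓ))` is continuous on the compact
configuration space (a finite product of copies of `G`), `G` is second countable through the closed
embedding `r.ρ`, so `wgt` is integrable for the product Haar probability measure and `∫ wgt dν > 0`
(`integral_exp_pos`); then `|Ex F| ≤ 1` for `|F| ≤ 1` (`abs_normalisedMean_le_one`) and every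
connected correlation is `≤ 2` (`abs_connected_le_two`). Constant `max C (2e^{mT})`, `β₂ := β₁`,
same rate.
-/

namespace Summit.QuantumFields.YangMills.Theorems.SmallCircleAnchor

open scoped BigOperators Topology Manifold Classical MeasureTheory ProbabilityTheory Matrix InnerProductSpace ComplexConjugate ContinuousMap
open Filter Set Function TopologicalSpace MeasureTheory

/-! ## Normalised means are honest averages -/

/-- For a non-negative integrable weight `w` with `∫ w > 0` and any `F` with `|F| ≤ 1` pointwise,
the normalised mean `(∫ F w dν)/(∫ w dν)` has modulus `≤ 1`. [folklore] -/
theorem abs_normalisedMean_le_one {Ω : Type*} [MeasurableSpace Ω] {ν : Measure Ω} {w : Ω → ℝ}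
    (hw0 : ∀ x, 0 ≤ w x) (hwi : Integrable w ν) (hpos : 0 < ∫ x, w x ∂ν)
    {F : Ω → ℝ} (hF : ∀ x, |F x| ≤ 1) :
    |(∫ x, F x * w x ∂ν) / (∫ x, w x ∂ν)| ≤ 1 := by
  have hnum : |∫ x, F x * w x ∂ν| ≤ ∫ x, w x ∂ν := by
    have h := norm_integral_le_of_norm_le (f := fun x => F x * w x) hwi
      (Eventually.of_forall fun x => by
        rw [Real.norm_eq_abs, abs_mul, abs_of_nonneg (hw0 x)]
        exact mul_le_of_le_one_left (hw0 x) (hF x))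
    simpa [Real.norm_eq_abs] using h
  rw [abs_div, abs_of_pos hpos, div_le_one hpos]
  exact hnum

/-- For a non-negative integrable weight `w` with `∫ w > 0` and `F, G` with `|F|, |G| ≤ 1`, the
connected correlation of the normalised means is bounded by `2`. [folklore] -/
theorem abs_connected_le_two {Ω : Type*} [MeasurableSpace Ω] {ν : Measure Ω} {w : Ω → ℝ}
    (hw0 : ∀ x, 0 ≤ w x) (hwi : Integrable w ν) (hpos : 0 < ∫ x, w x ∂ν)
    {F G : Ω → ℝ} (hF : ∀ x, |F x| ≤ 1) (hG : ∀ x, |G x| ≤ 1) :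
    |(∫ x, F x * G x * w x ∂ν) / (∫ x, w x ∂ν) -
        (∫ x, F x * w x ∂ν) / (∫ x, w x ∂ν) * ((∫ x, G x * w x ∂ν) / (∫ x, w x ∂ν))| ≤ 2 := by
  have hFG : ∀ x, |F x * G x| ≤ 1 := fun x => by
    rw [abs_mul]; exact mul_le_one₀ (hF x) (abs_nonneg _) (hG x)
  have h1 := abs_normalisedMean_le_one hw0 hwi hpos (F := fun x => F x * G x) hFG
  have h2 := abs_normalisedMean_le_one hw0 hwi hpos hF
  have h3 := abs_normalisedMean_le_one hw0 hwi hpos hG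
  calc _ ≤ |(∫ x, F x * G x * w x ∂ν) / (∫ x, w x ∂ν)| +
          |(∫ x, F x * w x ∂ν) / (∫ x, w x ∂ν) * ((∫ x, G x * w x ∂ν) / (∫ x, w x ∂ν))| :=
        abs_sub _ _
    _ ≤ 1 + 1 * 1 := by
        rw [abs_mul]
        exact add_le_add h1 (mul_le_mul h2 h3 (abs_nonneg _) zero_le_one)
    _ = 2 := by norm_num

/-! ## The registered stub `stub_decompactificationUniform` (reshape r1) -/

/-- **Decompactification with `T'`-uniform constants** (the soft variant): same outer setting as
`Decompactification`; `ClAt τ s β m w C L` is the body of the crux's `Cl τ s β m` at cube side `w`,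
constant `C` and spatial size `L` (so `Cl τ s β m = ∀ w, ∃ C, ∀ L, ClAt τ s β m w C L`
definitionally). Hypothesis: for `β ≥ β₁` one rate `m > 0` and, for every `w`, ONE constant `C`
serving every `T' ≥ T` and every `L`. Conclusion: the crux's `Cl (fun L => L) (E β) β m` for
`β ≥ β₁`. -/
def DecompactificationUniform : Prop :=
  ∀ (G : Type) [Group G] [TopologicalSpace G] [IsTopologicalGroup G] [CompactSpace G],
    Literature.MathematicalPhysics.QuantumFieldTheory.IsCompactSimpleLieGroup G →
    letI : MeasurableSpace G := borel G; haveI : BorelSpace G := ⟨rfl⟩;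
    ∀ (r : Literature.MathematicalPhysics.QuantumFieldTheory.LatticeRep G) (V : G → ℝ),
    (Continuous V ∧ (∀ a g : G, V (a * g * a⁻¹) = V g) ∧ ∃ g₀ : G, (∀ g : G, V g₀ ≤ V g) ∧ (∀ g : G, V g = V g₀ → ∃ a : G, g = a * g₀ * a⁻¹) ∧
      (∀ a b : G, a * g₀ = g₀ * a → b * g₀ = g₀ * b → a * b = b * a)) →
    ∀ (T : ℕ) [NeZero T],
    let ClAt := fun (τ : ℕ → ℕ) (s β m : ℝ) (w : ℕ) (C : ℝ) (L : ℕ) =>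
      ∀ [NeZero L] [NeZero (τ L)],
      let St := ZMod (τ L) × (Fin 3 → ZMod L);
      let Cfg := St × Option (Fin 3) → G;
      let ν : MeasureTheory.Measure Cfg := MeasureTheory.Measure.pi fun _ => Literature.MathematicalPhysics.QuantumFieldTheory.haarProbability G;
      let sh : St → Option (Fin 3) → St := fun x μ => Option.elim μ (x.1 + 1, x.2) fun i => (x.1, x.2 + Pi.single i 1);
      let pl : Cfg → St → Option (Fin 3) → Option (Fin 3) → G := fun U x μ κ => U (x, μ) * U (sh x μ, κ) * (U (sh x κ, μ))⁻¹ * (U (x, κ))⁻¹;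
      let act : Cfg → ℝ := fun U => β * ∑ x : St, ∑ i : Fin 3, (r.ρ (pl U x none (some i))).trace.re + β * ∑ x : St, ∑ q : {q : Fin 3 × Fin 3 // q.1 < q.2}, (r.ρ (pl U x (some q.1.1) (some q.1.2))).trace.re;
      let P : Cfg → (Fin 3 → ZMod L) → G := fun U x => (List.ofFn fun t : Fin (τ L) => U ((((t : ℕ) : ZMod (τ L)), x), none)).prod;
      let wgt : Cfg → ℝ := fun U => Real.exp (act U - s * ∑ x : Fin 3 → ZMod L, V (P U x));
      let Ex : (Cfg → ℝ) → ℝ := fun F => (∫ U, F U * wgt U ∂ν) / (∫ U, wgt U ∂ν);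
      let σ : ℕ → Cfg → Cfg := fun n U p => U ((p.1.1, p.1.2 + Pi.single 0 (n : ZMod L)), p.2);
      ∀ (c : Fin 3 → ZMod L),
      let Loc := fun F : Cfg → ℝ => Measurable F ∧ (∀ U, |F U| ≤ 1) ∧ ∀ U U', (∀ p, (∀ i : Fin 3, (p.1.2 i - c i).val ≤ w) → U p = U' p) → F U = F U';
      ∀ F₁ F₂ : Cfg → ℝ, Loc F₁ → Loc F₂ → ∀ n : ℕ, 2 * n < L →
        |Ex (fun U => F₁ U * F₂ (σ n U)) - Ex F₁ * Ex (fun U => F₂ (σ n U))| ≤ C * Real.exp (-(m * n));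
    let Cl := fun (τ : ℕ → ℕ) (s β m : ℝ) => ∀ w : ℕ, ∃ C : ℝ, ∀ L : ℕ, ClAt τ s β m w C L;
    ∀ (E : ℝ → ℝ) (β₁ : ℝ),
      (∀ β : ℝ, β₁ ≤ β → ∃ m : ℝ, 0 < m ∧
        ∀ w : ℕ, ∃ C : ℝ, ∀ (T' : ℕ), T ≤ T' → ∀ L : ℕ, ClAt (fun _ => T') (E β) β m w C L) →
      ∃ β₂ : ℝ, ∀ β : ℝ, β₂ ≤ β → ∃ m : ℝ, 0 < m ∧ Cl (fun L => L) (E β) β m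

/-- The soft variant holds: `T' := L` for `L ≥ T`, the trivial bound `2 ≤ 2e^{mT}e^{-mn}`
(`n < L < T`) for `L < T`; constant `max C (2 e^{mT})`, threshold `β₂ := β₁`, same rate. -/
theorem stub_decompactificationUniform : DecompactificationUniform := by
  intro G _ _ _ _ hG
  letI : MeasurableSpace G := borel G
  haveI : BorelSpace G := ⟨rfl⟩
  intro r V hV T _ ClAt Cl E β₁ hyp
  refine ⟨β₁, fun β hβ => ?_⟩
  obtain ⟨m, hm, hA⟩ := hyp β hβ
  refine ⟨m, hm, fun w => ?_⟩
  obtain ⟨C, hC⟩ := hA w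
  refine ⟨max C (2 * Real.exp (m * T)), fun L hL hτL => ?_⟩
  -- `G` is second countable (closed embedding `r.ρ` into matrices), so continuous maps on the
  -- finite product `Cfg` are measurable for the product σ-algebra.
  haveI : SecondCountableTopology G :=
    (r.continuous.isClosedEmbedding r.injective).isEmbedding.secondCountableTopology
  intro St Cfg ν sh pl act P wgt Ex σ c Loc F₁ F₂ hF₁ hF₂ n hn
  have hexp : 0 ≤ Real.exp (-(m * n)) := (Real.exp_pos _).le
  by_cases hTL : T ≤ L
  · -- the diagonal lattice `ℤ_L × (ℤ/L)³` IS the `T' := L` lattice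
    have key := @hC L hTL L hL hL c F₁ F₂ hF₁ hF₂ n hn
    exact key.trans (mul_le_mul_of_nonneg_right (le_max_left _ _) hexp)
  · -- `L < T`: the trivial bound
    push Not at hTL
    have hPcont : ∀ x : Fin 3 → ZMod L, Continuous fun U : Cfg => P U x := by
      intro x
      show Continuous fun U : Cfg =>
        (List.ofFn fun t : Fin L => U ((((t : ℕ) : ZMod L), x), none)).prod
      simp only [List.ofFn_eq_map]
      exact continuous_list_prod _ fun t _ => continuous_apply _
    have hpl : ∀ (x : St) (μ κ : Option (Fin 3)), Continuous fun U : Cfg => pl U x μ κ := by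
      intro x μ κ
      show Continuous fun U : Cfg => U (x, μ) * U (sh x μ, κ) * (U (sh x κ, μ))⁻¹ * (U (x, κ))⁻¹
      fun_prop
    have htr : ∀ (x : St) (μ κ : Option (Fin 3)),
        Continuous fun U : Cfg => (r.ρ (pl U x μ κ)).trace.re := fun x μ κ =>
      Complex.continuous_re.comp (r.continuous.comp (hpl x μ κ)).matrix_trace
    have hact : Continuous act :=
      (continuous_const.mul (continuous_finsetSum _ fun x _ =>
        continuous_finsetSum _ fun i _ => htr x none (some i))).add
      (continuous_const.mul (continuous_finsetSum _ fun x _ =>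
        continuous_finsetSum _ fun q _ => htr x (some q.1.1) (some q.1.2)))
    have hwgt : Continuous wgt :=
      Real.continuous_exp.comp (hact.sub (continuous_const.mul
        (continuous_finsetSum _ fun x _ => hV.1.comp (hPcont x))))
    have hwi : Integrable wgt ν :=
      hwgt.integrable_of_hasCompactSupport (HasCompactSupport.of_compactSpace _)
    have hpos : 0 < ∫ U, wgt U ∂ν := integral_exp_pos hwi
    have hw0 : ∀ U, 0 ≤ wgt U := fun U => Real.exp_nonneg _
    have h2 : |Ex (fun U => F₁ U * F₂ (σ n U)) - Ex F₁ * Ex (fun U => F₂ (σ n U))| ≤ 2 :=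
      abs_connected_le_two hw0 hwi hpos hF₁.2.1 (fun U => hF₂.2.1 _)
    have hnT : (n : ℝ) ≤ T := by
      have : n ≤ T := by omega
      exact_mod_cast this
    have hone : 1 ≤ Real.exp (m * T) * Real.exp (-(m * n)) := by
      rw [← Real.exp_add]
      exact Real.one_le_exp (by nlinarith [hm.le])
    calc _ ≤ 2 := h2
      _ ≤ 2 * Real.exp (m * T) * Real.exp (-(m * n)) := by nlinarith
      _ ≤ max C (2 * Real.exp (m * T)) * Real.exp (-(m * n)) :=
          mul_le_mul_of_nonneg_right (le_max_right _ _) hexp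

end Summit.QuantumFields.YangMills.Theorems.SmallCircleAnchor
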